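import Literature.Barriers.CriticalPhenomena.WeaklySAWFieldRescaling
import Literature.Barriers.CriticalPhenomena.WeaklySAWFluctuationDegreeZero
import Literature.Barriers.CriticalPhenomena.WeaklySAWGaussianConvolution
import HarnessLib

/-!
# BBS 2015, §4.1, eqs. (4.14), (4.17)–(4.20), (4.25)–(4.26): the bosonic generating functional
# `Σ(J,J̄) = E_C(e^{(J,φ̄)+(φ,J̄)} Z₀)` and completion of the square, `Σ(J,J̄) = e^{(J,CJ̄)} Z_N⁰(CJ, CJ̄)`

Sequel to `WeaklySAWFieldRescaling.lean` (translation invariance of the super-integral,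
`superIntegral_substForm_const_add`). Bauerschmidt–Brydges–Slade, CMP 337 (2015), arXiv:1403.7422, §4.1:
with `C = (-Δ+m²)⁻¹`, `A = C⁻¹`, `Z₀ = e^{-V₀(Λ)}` and an external field `J : Λ → ℂ`,
`(J,φ̄) = Σ_x J_xφ̄_x`, `(φ,J̄) = Σ_x φ_xJ̄_x` ((4.13')), the generating functional is
`Σ(J,J̄) = E_C(e^{(J,φ̄)+(φ,J̄)} Z₀)` ((4.14)); completing the square ((4.18)–(4.19):
`(φ,Aφ̄) + (ψ,Aψ̄) - (J,φ̄) - (φ,J̄) = (φ-CJ, A(φ̄-CJ̄)) + (ψ,Aψ̄) - (J,CJ̄)`) and translating the bosonic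
integration variable `φ ↦ φ + CJ` ("this translation of `φ` leaves `ψ` unchanged") gives (4.17)/(4.20)
`Σ(J,J̄) = e^{(J,CJ̄)} E_C(Z₀(φ+CJ, φ̄+CJ̄, ψ, ψ̄))`, written (4.25) as `e^{(J,CJ̄)} Z_N⁰(CJ,CJ̄)` with `Z_N⁰` the
degree-zero part of `Z_N = E_Cθ Z₀` ((4.21)–(4.24)).

* `extSource J` (`e^{(J,φ̄)+(φ,J̄)}` as a `0`-form), **`genFunctional … J = Σ(J,J̄)`** (4.14);
* **`ZN0 … h = E_C(Z₀(h+φ, h̄+φ̄, ψ, ψ̄))`** — the function `Z_N⁰ : ℂ^Λ → ℂ` of (4.24)–(4.25), written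
  directly as the translated expectation; **`ZN0_eq_degZero_convTheta`** identifies it with the source's
  definition, the degree-`0` part of `Z_N = E_Cθ Z₀` ((4.23)–(4.24), `θ` and `E_Cθ` of
  `WeaklySAWFieldDoubling.lean` / `WeaklySAWFluctuationIntegral.lean`, via `degZero_convTheta` of
  `WeaklySAWFluctuationDegreeZero.lean`). `ZN0_zero`: `Z_N⁰(0) = E_C Z₀`;
* the algebra of the translation: `substForm_fermionAction`, `substForm_superGauss`
  (`e^{-S_A}(h+φ,ψ) = e^{-(φ+h)A(φ̄+h̄)}e^{-ψAψ̄}`), `quadForm_add_eq'` of the Gaussian-convolution file (the scalar identity (4.19) evaluated: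
  for `Aᵀ = A` with real entries and `Ah = J`,
  `e^{-(φ+h)A(φ̄+h̄)} e^{(J,φ̄+h̄)+(φ+h,J̄)} = e^{(h,J̄)} e^{-φAφ̄}`);
* **`genFunctional_eq`** = (4.17)/(4.20)/(4.25): `Σ(J,J̄) = e^{(J,CJ̄)} Z_N⁰(CJ)` for `m² > 0`, every
  `g₀, ν₀, z₀` and every `J` (with `(J,CJ̄) = Σ_x(CJ)_xJ̄_x`, `pair_freeCovariance_comm`: `= Σ_xJ_x(CJ̄)_x`,
  `C` being real symmetric: `conj_freeCovariance`, `freeCovariance_transpose`);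
* **`genFunctional_const`** = (4.25) with (4.26) for the constant field `J = z1`:
  `Σ(z1, z̄1) = e^{|Λ||z|²/m²} Z_N⁰((z/m²)1)` (`C1 = m⁻²1`).

Everything is proved; no named facts. The differentiation `χ̂_N = |Λ|⁻¹D²Σ(0,0;1,1)` ((4.16)) and (4.27)
are not in this file.
-/

noncomputable section

open MeasureTheory Filter Topology Set Complex ComplexConjugate
open scoped ENNReal
open Literature.Probability.LatticeModels
open Literature.MathematicalPhysics.QuantumLattice
open Literature.MathematicalPhysics.QuantumLattice.GrassmannAlgebra (berezin)
open scoped BigOperators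

namespace Literature.Barriers.CriticalPhenomena

namespace CTWSAW

/-! ### Translating the super-Gaussian; the completed square -/

section Translate

variable {Λ : Type*} [Fintype Λ] [LinearOrder Λ]

/-- Substitutions in `φ` fix the fermionic action `ψBψ̄` (constant coefficients). [folklore] -/
theorem substForm_fermionAction (u : (Λ → ℂ) → (Λ → ℂ)) (B : Matrix Λ Λ ℂ) :
    substForm u (fermionAction B) = fermionAction B := by
  unfold fermionAction
  rw [map_sum]
  refine Finset.sum_congr rfl fun x _ => ?_
  rw [map_sum]
  refine Finset.sum_congr rfl fun y _ => ?_
  rw [substForm_smul, fieldPrecomp_constFun, map_mul, substForm_psi, substForm_psiBar]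

/-- **`e^{-S_A}` under `φ ↦ u(φ)`**: `e^{-u(φ)Au(φ)‾} e^{-ψAψ̄}`. [folklore] -/
theorem substForm_superGauss (u : (Λ → ℂ) → (Λ → ℂ)) (B : Matrix Λ Λ ℂ) :
    substForm u (superGauss B) = ofFun (fun φ => Boson.gaussWeight B (u φ)) * grassmannExp (-fermionAction B) := by
  have hnil : IsNilpotent (-fermionAction B) := by
    rw [fermionAction_eq_neg_quadratic, neg_neg]; exact isNilpotent_quadratic _ _
  rw [superGauss, map_mul, substForm_ofFun, substForm_grassmannExp u hnil, map_neg, substForm_fermionAction]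

omit [LinearOrder Λ] in
/-- **The scalar factor of (4.20)**: `e^{-(φ+h)A(φ̄+h̄)} e^{(J,φ̄+h̄)+(φ+h,J̄)} = e^{(h,J̄)} e^{-φAφ̄}` for
`Aᵀ = A` real and `Ah = J`. [cite: BauerschmidtBrydgesSlade2015LogCorr, §4.1, eqs. (4.17)–(4.20)] -/
theorem gaussWeight_add_mul_cexp_pair {A : Matrix Λ Λ ℂ} (hAt : A.transpose = A)
    (hAr : ∀ x y, conj (A x y) = A x y) {h J : Λ → ℂ} (hAh : A.mulVec h = J) (φ : Λ → ℂ) :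
    Boson.gaussWeight A (h + φ) * cexp (pair J (h + φ) + pair (h + φ) J) =
      cexp (pair h J) * Boson.gaussWeight A φ := by
  rw [Boson.gaussWeight, Boson.gaussWeight, ← Complex.exp_add, ← Complex.exp_add, quadForm_add_eq' hAt hAr hAh,
    pair_add_right, pair_add_left]
  congr 1
  -- `(J, h̄) = (h, J̄)`: both equal `Σ_{x,y} h_x A_xy h̄_y` by symmetry and realness
  have hsymm : ∀ x y, A y x = A x y := fun x y => by
    have e := congrFun (congrFun hAt x) y
    rwa [Matrix.transpose_apply] at e
  have hJ : ∀ x, J x = ∑ y, A x y * h y := fun x => by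
    rw [← hAh]; rfl
  have hsym : pair J h = pair h J := by
    unfold pair
    simp_rw [hJ, map_sum, map_mul, hAr, Finset.sum_mul, Finset.mul_sum]
    rw [Finset.sum_comm]
    refine Finset.sum_congr rfl fun x _ => Finset.sum_congr rfl fun y _ => ?_
    rw [hsymm x y]
    ring
  rw [hsym]
  ring

end Translate

/-! ### The torus: `Σ(J,J̄)`, `Z_N⁰`, and the completion of the square -/

section Torus

variable {d n : ℕ} [NeZero n]

attribute [-instance] Fintype.decidablePiFintype

/-- `-Δ+m²` has real entries. [folklore] -/
theorem conj_massLaplacianC (m2 : ℝ) (x y : TorusSite d n) :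
    conj (massLaplacianC d n m2 x y) = massLaplacianC d n m2 x y := by
  simp only [massLaplacianC, negLaplacianC, schrodingerMatrixC, Matrix.add_apply, Matrix.sub_apply,
    Matrix.diagonal_apply, torusStepMatrixC, Matrix.map_apply, Pi.zero_apply, add_zero]
  split_ifs <;> simp [Complex.conj_ofReal, map_ofNat]

/-- `-Δ+m²` is symmetric. [folklore] -/
theorem massLaplacianC_transpose (m2 : ℝ) : (massLaplacianC d n m2).transpose = massLaplacianC d n m2 := by
  ext x y
  simp only [Matrix.transpose_apply, massLaplacianC, Matrix.add_apply, Matrix.diagonal_apply, negLaplacianC_symm y x]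
  congr 1
  by_cases h : x = y
  · subst h; rfl
  · rw [if_neg h, if_neg (Ne.symm h)]

/-- **`-Δ+m²` is real symmetric positive-definite** (`m² > 0`): the free kinetic matrix
`A = C⁻¹ = -Δ+m²` belongs to the hypothesis class `RealPosDef` of the Gaussian-convolution files
(`WeaklySAWGaussianConvolution.lean`, Proposition 5.1), with lower bound `m²`.
[cite: BauerschmidtBrydgesSlade2015LogCorr, §4.1 ("Let C = (-Δ+m²)⁻¹"; m² > 0)] -/
theorem realPosDef_massLaplacianC {m2 : ℝ} (hm : 0 < m2) : RealPosDef (massLaplacianC d n m2) m2 where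
  symm := massLaplacianC_transpose m2
  real := conj_massLaplacianC m2
  pos := hm
  bound := re_quadForm_massLaplacianC_ge m2

/-- **`C = (-Δ+m²)⁻¹` has real entries** (`m² > 0`). [folklore] -/
theorem conj_freeCovariance {m2 : ℝ} (hm : 0 < m2) (x y : TorusSite d n) :
    conj (freeCovariance d n m2 x y) = freeCovariance d n m2 x y := by
  -- the entrywise conjugate of `C` is again a left inverse of `A = conj A`
  have hA : (massLaplacianC d n m2).map (starRingEnd ℂ) = massLaplacianC d n m2 := by
    ext i j; exact conj_massLaplacianC m2 i j
  have hleft : (freeCovariance d n m2).map (starRingEnd ℂ) * massLaplacianC d n m2 = 1 := by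
    conv_lhs => rw [← hA]
    rw [← Matrix.map_mul, freeCovariance, Matrix.nonsing_inv_mul _ (isUnit_det_massLaplacianC hm), Matrix.map_one]
    · exact map_zero _
    · exact map_one _
  have h := Matrix.inv_eq_left_inv hleft
  have h' : freeCovariance d n m2 = (freeCovariance d n m2).map (starRingEnd ℂ) := h
  exact (congrFun (congrFun h' x) y).symm

/-- `C` is symmetric. [folklore] -/
theorem freeCovariance_transpose (m2 : ℝ) :
    (freeCovariance d n m2).transpose = freeCovariance d n m2 := by
  rw [freeCovariance, Matrix.transpose_nonsing_inv, massLaplacianC_transpose]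

/-- `A(CJ) = J` for `A = -Δ+m²`, `C = A⁻¹`, `m² > 0`. [folklore] -/
theorem massLaplacianC_mulVec_freeCovariance_mulVec {m2 : ℝ} (hm : 0 < m2) (J : TorusSite d n → ℂ) :
    (massLaplacianC d n m2).mulVec ((freeCovariance d n m2).mulVec J) = J := by
  rw [Matrix.mulVec_mulVec, freeCovariance, Matrix.mul_nonsing_inv _ (isUnit_det_massLaplacianC hm), Matrix.one_mulVec]

/-- `(J, (CJ)‾) = (CJ, J̄)`: the pairing with the real symmetric `C` is symmetric. [folklore] -/
theorem pair_freeCovariance_comm {m2 : ℝ} (hm : 0 < m2) (J : TorusSite d n → ℂ) :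
    pair J ((freeCovariance d n m2).mulVec J) = pair ((freeCovariance d n m2).mulVec J) J := by
  unfold pair Matrix.mulVec dotProduct
  simp_rw [map_sum, map_mul, conj_freeCovariance hm, Finset.mul_sum, Finset.sum_mul]
  rw [Finset.sum_comm]
  refine Finset.sum_congr rfl fun x _ => Finset.sum_congr rfl fun y _ => ?_
  have e := congrFun (congrFun (freeCovariance_transpose (d := d) (n := n) m2) x) y
  rw [Matrix.transpose_apply] at e
  rw [e]
  ring

/-- **The external-field factor `e^{(J,φ̄)+(φ,J̄)}`** as a `0`-form. [cite: BauerschmidtBrydgesSlade2015LogCorr, §4.1, eq. (4.14)] -/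
def extSource (J : TorusSite d n → ℂ) : SForm (TorusSite d n) :=
  ofFun fun φ => cexp (pair J φ + pair φ J)

/-- **The bosonic generating functional `Σ(J,J̄) = E_C(e^{(J,φ̄)+(φ,J̄)} Z₀)`**, `C = (-Δ+m²)⁻¹`,
`Z₀ = e^{-V₀(Λ)}` (here with `J̄` the complex conjugate of `J`).
[cite: BauerschmidtBrydgesSlade2015LogCorr, §4.1, eq. (4.14)] -/
def genFunctional (d n : ℕ) [NeZero n] (m2 g₀ ν₀ z₀ : ℝ) (J : TorusSite d n → ℂ) : ℂ :=
  superExpectation (freeCovariance d n m2) (extSource J * boltzmannZ0 g₀ ν₀ z₀)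

/-- **`Z_N⁰(h) = E_C(Z₀(h+φ, h̄+φ̄, ψ, ψ̄))`**: the translated expectation of `Z₀`, i.e. the degree-zero part
of `Z_N = E_Cθ Z₀` at the external field `h` ((4.21)–(4.24): `θF(φ,ψ) = F(φ+ξ, ψ+η)`, `E_C` integrating
the fluctuation fields `ξ, η`). [cite: BauerschmidtBrydgesSlade2015LogCorr, §4.1, eqs. (4.23)–(4.25)] -/
def ZN0 (d n : ℕ) [NeZero n] (m2 g₀ ν₀ z₀ : ℝ) (h : TorusSite d n → ℂ) : ℂ :=
  superExpectation (freeCovariance d n m2) (substForm (fun φ => h + φ) (boltzmannZ0 g₀ ν₀ z₀))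

/-- **`Z_N⁰` is the degree-zero part of `Z_N = E_C θ Z₀`** ((4.23)–(4.24)), evaluated at the external
field `h` (`m² > 0`, `A = C⁻¹ = -Δ+m²`). [cite: BauerschmidtBrydgesSlade2015LogCorr, §4.1, eqs. (4.23)–(4.24)] -/
theorem ZN0_eq_degZero_convTheta {m2 : ℝ} (hm : 0 < m2) (g₀ ν₀ z₀ : ℝ) (h : TorusSite d n → ℂ) :
    ZN0 d n m2 g₀ ν₀ z₀ h = degZero (convTheta (massLaplacianC d n m2) (boltzmannZ0 g₀ ν₀ z₀)) h := by
  rw [ZN0, superExpectation_freeCovariance hm, degZero_convTheta]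

/-- `Z_N⁰(0) = E_C Z₀` (the partition function). [folklore] -/
theorem ZN0_zero (m2 g₀ ν₀ z₀ : ℝ) :
    ZN0 d n m2 g₀ ν₀ z₀ 0 = superExpectation (freeCovariance d n m2) (boltzmannZ0 g₀ ν₀ z₀) := by
  unfold ZN0
  congr 2
  have h : substForm (fun φ : TorusSite d n → ℂ => (0 : TorusSite d n → ℂ) + φ) = substForm id := by
    congr 1; funext φ; exact zero_add φ
  rw [h]
  change GrassmannAlgebra.coeffMap (fieldPrecomp id) (boltzmannZ0 g₀ ν₀ z₀) = boltzmannZ0 g₀ ν₀ z₀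
  have hid : fieldPrecomp (id : (TorusSite d n → ℂ) → (TorusSite d n → ℂ)) = RingHom.id _ := rfl
  rw [hid]
  exact GrassmannAlgebra.coeffMap_id _

/-- **BBS 2015, eqs. (4.17)/(4.20)/(4.25): `Σ(J,J̄) = e^{(J,CJ̄)} Z_N⁰(CJ, CJ̄)`** — completion of the square
and translation of the bosonic integration variable `φ ↦ φ + CJ` (`m² > 0`; every `g₀, ν₀, z₀, J`); here
`(J,CJ̄)` appears as `(CJ, J̄) = Σ_x (CJ)_x J̄_x` (equal to `Σ_x J_x (CJ̄)_x` by `pair_freeCovariance_comm`).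
[cite: BauerschmidtBrydgesSlade2015LogCorr, §4.1, eqs. (4.17)–(4.20) and (4.25)] -/
theorem genFunctional_eq {m2 : ℝ} (hm : 0 < m2) (g₀ ν₀ z₀ : ℝ) (J : TorusSite d n → ℂ) :
    genFunctional d n m2 g₀ ν₀ z₀ J =
      cexp (pair ((freeCovariance d n m2).mulVec J) J) * ZN0 d n m2 g₀ ν₀ z₀ ((freeCovariance d n m2).mulVec J) := by
  set h : TorusSite d n → ℂ := (freeCovariance d n m2).mulVec J with hh
  set A := massLaplacianC d n m2 with hA
  have hscal : ∀ φ : TorusSite d n → ℂ, Boson.gaussWeight A (h + φ) * cexp (pair J (h + φ) + pair (h + φ) J) =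
      cexp (pair h J) * Boson.gaussWeight A φ := fun φ =>
    gaussWeight_add_mul_cexp_pair (massLaplacianC_transpose m2) (conj_massLaplacianC m2)
      (massLaplacianC_mulVec_freeCovariance_mulVec hm J) φ
  rw [genFunctional, ZN0, superExpectation_freeCovariance hm, superExpectation_freeCovariance hm,
    ← superIntegral_substForm_const_add h (superGauss _ * _), map_mul, map_mul, substForm_superGauss, extSource,
    substForm_ofFun, ← superIntegral_constFun_mul]
  congr 1
  -- `(a E)(b Z') = (a b)(E Z')` with `a b = (e^{(h,J̄)}·1) gW`
  set E : SForm (TorusSite d n) := grassmannExp (-fermionAction (massLaplacianC d n m2)) with hE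
  set Z' : SForm (TorusSite d n) := substForm (fun φ => h + φ) (boltzmannZ0 g₀ ν₀ z₀) with hZ'
  rw [mul_assoc (ofFun _) E, ← mul_assoc E, ← ofFun_comm _ E, mul_assoc (ofFun _) E Z', ← mul_assoc (ofFun _) (ofFun _),
    ofFun_mul_ofFun, superGauss, ← hE, mul_assoc (ofFun _) E Z', ← mul_assoc (ofFun (constFun _)) (ofFun _) (E * Z'),
    ofFun_mul_ofFun]
  congr 2
  funext φ
  simp only [Pi.mul_apply, constFun]
  exact hscal φ

/-- **BBS 2015, (4.25) with (4.26) for the constant external field `J = z1`**: `CJ = (z/m²)1`,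
`(J,CJ̄) = |Λ||z|²/m²`, hence `Σ(z1, z̄1) = e^{|Λ||z|²/m²} Z_N⁰((z/m²)1)` (`m² > 0`).
[cite: BauerschmidtBrydgesSlade2015LogCorr, §4.1, eqs. (4.25)–(4.26)] -/
theorem genFunctional_const {m2 : ℝ} (hm : 0 < m2) (g₀ ν₀ z₀ : ℝ) (z : ℂ) :
    genFunctional d n m2 g₀ ν₀ z₀ (fun _ => z) =
      cexp ((Fintype.card (TorusSite d n) : ℂ) * (z * conj z) / (m2 : ℂ)) *
        ZN0 d n m2 g₀ ν₀ z₀ (fun _ => z / (m2 : ℂ)) := by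
  have hCJ : (freeCovariance d n m2).mulVec (fun _ => z) = fun _ => z / (m2 : ℂ) := by
    have h1 := freeCovariance_mulVec_one (d := d) (n := n) hm
    have h2 : (fun _ : TorusSite d n => z) = z • fun _ => (1 : ℂ) := by funext x; simp
    rw [h2, Matrix.mulVec_smul, h1]
    funext x; simp [div_eq_mul_inv]
  rw [genFunctional_eq hm, hCJ]
  congr 2
  unfold pair
  rw [Finset.sum_const, Finset.card_univ, nsmul_eq_mul]
  have hm' : (m2 : ℂ) ≠ 0 := by exact_mod_cast hm.ne'
  field_simp

end Torus

end CTWSAW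

end Literature.Barriers.CriticalPhenomena
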